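import Summits.NavierStokesRegularity.NavierStokesRegularity.Theorems.FilamentSkeletonRssExchangeDefs

/-!
# Route `FilamentSkeletonRss` — exchange-certificate API, II: unfolding the four exponents

`FilamentExchange.ExchangeCertificate` compares infima (`exportExp`, `importExp`, `importExpOr`,
through `weightExp`, `footCost`, `captured`, all `sInf`s in `ℝ≥0∞`).  This file unfolds each of them
ONCE into the two forms its users need, so that neither the certifier (`CertifiedSelectionBox`:
interval arithmetic on explicit paths and barrier functions) nor the signed reduction
(`SignedTransverseReduction`) ever manipulates `sInf` directly:

* WITNESS UPPER BOUNDS (`…_le_of_…`): an admissible tuple bounds the infimum from above;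
* POINTWISE LOWER BOUNDS (`le_…`): a bound valid for every admissible tuple bounds the infimum from
  below (combine with `le_qPot_of_subsolution` of part I for the quasipotential term);
* `captured`: membership from a zero-cost connection, non-membership from a uniform positive lower
  bound on the cost of reaching the wall.

All proofs are order-theoretic (`sInf_le`, `le_sInf`); no analysis.
-/

set_option linter.dupNamespace false -- the module path `Summits.NavierStokesRegularity.NavierStokesRegularity.…` repeats a component by layout (D-0017)

noncomputable section

namespace Summit.NavierStokesRegularity.NavierStokesRegularity.Theorems.FilamentExchange

open scoped Topology ENNReal InnerProductSpace RealInnerProductSpace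
open Set Function MeasureTheory

variable {N : ℕ} {W : EuclideanSpace ℝ (Fin 3) → EuclideanSpace ℝ (Fin 3)}
  {Y : Fin N → ℝ → EuclideanSpace ℝ (Fin 3)} {P : Fin N → ℝ → ℝ} {r R : ℝ} {j : Fin N}

/-! ### `footCost` -/

/-- A foot `s` within `2r` bounds the foot cost by `P s`. [folklore] -/
theorem footCost_le {Pk : ℝ → ℝ} {Yk : ℝ → EuclideanSpace ℝ (Fin 3)} {ρ : ℝ}
    {ζ : EuclideanSpace ℝ (Fin 3)} {s : ℝ} (hs : ‖ζ - Yk s‖ ≤ 2 * ρ) :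
    footCost Pk Yk ρ ζ ≤ ENNReal.ofReal (Pk s) :=
  sInf_le ⟨s, hs, rfl⟩

/-- A bound valid at every foot within `2r` bounds the foot cost from below. [folklore] -/
theorem le_footCost {Pk : ℝ → ℝ} {Yk : ℝ → EuclideanSpace ℝ (Fin 3)} {ρ : ℝ}
    {ζ : EuclideanSpace ℝ (Fin 3)} {m : ℝ≥0∞} (h : ∀ s : ℝ, ‖ζ - Yk s‖ ≤ 2 * ρ → m ≤ ENNReal.ofReal (Pk s)) :
    m ≤ footCost Pk Yk ρ ζ :=
  le_sInf (by rintro q ⟨s, hs, rfl⟩; exact h s hs)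

/-! ### `weightExp` -/

/-- A wall point `ζ` of `j` bounds the weight exponent of `b` by `V(b → ζ) + footCost ζ`. [folklore] -/
theorem weightExp_le {b ζ : EuclideanSpace ℝ (Fin 3)} (hζ : ζ ∈ wall Y r R j) :
    weightExp W Y P r R j b ≤ qPot W (visible Y r R) b ζ + footCost (P j) (Y j) r ζ :=
  sInf_le ⟨ζ, hζ, rfl⟩

/-- A bound valid at every wall point of `j` bounds the weight exponent from below. [folklore] -/
theorem le_weightExp {b : EuclideanSpace ℝ (Fin 3)} {m : ℝ≥0∞}
    (h : ∀ ζ, ζ ∈ wall Y r R j → m ≤ qPot W (visible Y r R) b ζ + footCost (P j) (Y j) r ζ) :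
    m ≤ weightExp W Y P r R j b :=
  le_sInf (by rintro q ⟨ζ, hζ, rfl⟩; exact h ζ hζ)

/-! ### `captured` -/

/-- A visible point connected to the wall of `j` at zero cost is captured. [folklore] -/
theorem mem_captured {b ζ : EuclideanSpace ℝ (Fin 3)} (hb : b ∈ visible Y r R) (hζ : ζ ∈ wall Y r R j)
    (h0 : qPot W (visible Y r R) b ζ = 0) : b ∈ captured W Y r R j := by
  refine ⟨hb, le_antisymm ?_ bot_le⟩
  have h1 : sInf {q : ℝ≥0∞ | ∃ ζ : EuclideanSpace ℝ (Fin 3), ζ ∈ wall Y r R j ∧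
      q = qPot W (visible Y r R) b ζ} ≤ qPot W (visible Y r R) b ζ := sInf_le ⟨ζ, hζ, rfl⟩
  exact h1.trans h0.le

/-- A uniform positive lower bound on the cost of reaching the wall of `j` from `b` shows that `b` is
NOT captured (the certifier's form: a barrier separating `b` from tube `j`). [folklore] -/
theorem not_mem_captured {b : EuclideanSpace ℝ (Fin 3)} {m : ℝ≥0∞} (hm : m ≠ 0)
    (h : ∀ ζ, ζ ∈ wall Y r R j → m ≤ qPot W (visible Y r R) b ζ) : b ∉ captured W Y r R j := by
  rintro ⟨-, h0⟩
  have : m ≤ 0 := by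
    rw [← h0]
    exact le_sInf (by rintro q ⟨ζ, hζ, rfl⟩; exact h ζ hζ)
  exact hm (le_antisymm this bot_le)

/-- Points outside the visible region are never captured. [folklore] -/
theorem not_mem_captured_of_not_visible {b : EuclideanSpace ℝ (Fin 3)} (hb : b ∉ visible Y r R) :
    b ∉ captured W Y r R j := fun h => hb h.1

/-! ### `exportExp` -/

/-- An explicit excursion (wall point `ξ` of `j`, visible non-captured target `b`) bounds the export
exponent from above by `V(ξ → b) + Θ_j(b)`. [folklore] -/
theorem exportExp_le {ξ b : EuclideanSpace ℝ (Fin 3)} (hξ : ξ ∈ wall Y r R j) (hb : b ∈ visible Y r R)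
    (hnc : b ∉ captured W Y r R j) :
    exportExp W Y P r R j ≤ qPot W (visible Y r R) ξ b + weightExp W Y P r R j b :=
  sInf_le ⟨ξ, b, hξ, hb, hnc, rfl⟩

/-- A bound valid for every admissible excursion bounds the export exponent from below. [folklore] -/
theorem le_exportExp {m : ℝ≥0∞}
    (h : ∀ ξ b, ξ ∈ wall Y r R j → b ∈ visible Y r R → b ∉ captured W Y r R j →
      m ≤ qPot W (visible Y r R) ξ b + weightExp W Y P r R j b) :
    m ≤ exportExp W Y P r R j :=
  le_sInf (by rintro q ⟨ξ, b, hξ, hb, hnc, rfl⟩; exact h ξ b hξ hb hnc)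

/-! ### `importExp` -/

/-- An explicit source (`x` on the window sphere or on another wall) and wall point `ζ` of `j` bound
the unsigned import exponent from above. [folklore] -/
theorem importExp_le {x ζ : EuclideanSpace ℝ (Fin 3)}
    (hx : x ∈ Metric.sphere (0 : EuclideanSpace ℝ (Fin 3)) R ∨ ∃ k, k ≠ j ∧ x ∈ wall Y r R k)
    (hζ : ζ ∈ wall Y r R j) :
    importExp W Y P r R j ≤ qPot W (visible Y r R) x ζ + footCost (P j) (Y j) r ζ :=
  sInf_le ⟨x, ζ, hx, hζ, rfl⟩

/-- A bound valid for every admissible (source, wall point) pair bounds the unsigned import exponent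
from below (the face-`p_j = 1` obligation `e_j + g₀ ≤ i_j` is certified in this form). [folklore] -/
theorem le_importExp {m : ℝ≥0∞}
    (h : ∀ x ζ, (x ∈ Metric.sphere (0 : EuclideanSpace ℝ (Fin 3)) R ∨ ∃ k, k ≠ j ∧ x ∈ wall Y r R k) →
      ζ ∈ wall Y r R j → m ≤ qPot W (visible Y r R) x ζ + footCost (P j) (Y j) r ζ) :
    m ≤ importExp W Y P r R j :=
  le_sInf (by rintro q ⟨x, ζ, hx, hζ, rfl⟩; exact h x ζ hx hζ)

/-! ### `importExpOr` -/

/-- An explicit oriented donor path bounds the oriented import exponent from above. [folklore] -/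
theorem importExpOr_le {sg : Fin N → ℝ} {ε : ℝ} {k : Fin N} {σ s T : ℝ}
    {φ ℓ : ℝ → EuclideanSpace ℝ (Fin 3)} (hk : k ≠ j) (hT : 0 ≤ T) (hφ : ContDiff ℝ 1 φ)
    (h0 : φ 0 ∈ wall Y r R k) (h0' : ‖φ 0 - Y k σ‖ ≤ 2 * r) (h1 : φ T ∈ wall Y r R j)
    (h1' : ‖φ T - Y j s‖ ≤ 2 * r) (hS : ∀ t ∈ Icc 0 T, φ t ∈ visible Y r R)
    (hℓ0 : ℓ 0 = sg k • deriv (Y k) σ) (hℓ : ∀ t, HasDerivAt ℓ (fderiv ℝ W (φ t) (ℓ t)) t)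
    (hor : 0 < ε * sg j * ⟪ℓ T, deriv (Y j) s⟫) :
    importExpOr W Y sg P r R j ε ≤ ENNReal.ofReal (fwAction W T φ) + ENNReal.ofReal (P j s) :=
  sInf_le ⟨k, σ, s, T, φ, ℓ, hk, hT, hφ, h0, h0', h1, h1', hS, hℓ0, hℓ, hor, rfl⟩

/-- A bound valid for every admissible oriented donor path bounds the oriented import exponent from
below (the face-`p_j = 0` obligation uses this for `ε = −1`, the face-`p_j = 1` one through
`importExp`). [folklore] -/
theorem le_importExpOr {sg : Fin N → ℝ} {ε : ℝ} {m : ℝ≥0∞}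
    (h : ∀ (k : Fin N) (σ s T : ℝ) (φ ℓ : ℝ → EuclideanSpace ℝ (Fin 3)), k ≠ j → 0 ≤ T →
      ContDiff ℝ 1 φ → φ 0 ∈ wall Y r R k → ‖φ 0 - Y k σ‖ ≤ 2 * r → φ T ∈ wall Y r R j →
      ‖φ T - Y j s‖ ≤ 2 * r → (∀ t ∈ Icc 0 T, φ t ∈ visible Y r R) → ℓ 0 = sg k • deriv (Y k) σ →
      (∀ t, HasDerivAt ℓ (fderiv ℝ W (φ t) (ℓ t)) t) → 0 < ε * sg j * ⟪ℓ T, deriv (Y j) s⟫ →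
      m ≤ ENNReal.ofReal (fwAction W T φ) + ENNReal.ofReal (P j s)) :
    m ≤ importExpOr W Y sg P r R j ε :=
  le_sInf (by
    rintro q ⟨k, σ, s, T, φ, ℓ, hk, hT, hφ, h0, h0', h1, h1', hS, hℓ0, hℓ, hor, rfl⟩
    exact h k σ s T φ ℓ hk hT hφ h0 h0' h1 h1' hS hℓ0 hℓ hor)

/-! ### The certificate, clause by clause -/

/-- **Reading the certificate on the face `p_j = 1`.** [folklore] -/
theorem ExchangeCertificate.face_one {Γ ρ Rw g₀ : ℝ} {γ : (Fin N → ℝ) → Fin N → ℝ}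
    {X : (Fin N → ℝ) → Fin N → ℝ → EuclideanSpace ℝ (Fin 3)} {w : (Fin N → ℝ) → Fin N → ℝ → ℝ}
    {c : (Fin N → ℝ) → Fin N → ℝ}
    {v : (Fin N → ℝ) → EuclideanSpace ℝ (Fin 3) → EuclideanSpace ℝ (Fin 3)}
    (h : ExchangeCertificate N Γ ρ Rw g₀ γ X w c v) {p : Fin N → ℝ} (hp : ∀ i, p i ∈ Icc (0:ℝ) 1)
    {j : Fin N} (hj : p j = 1) :
    exportExp (rsField Γ (v p)) (fun k => rsCurve Γ (X p k)) (fun k => axialPot Γ (w p k) (c p k))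
        (ρ/4) Rw j + ENNReal.ofReal g₀
      ≤ importExp (rsField Γ (v p)) (fun k => rsCurve Γ (X p k)) (fun k => axialPot Γ (w p k) (c p k))
        (ρ/4) Rw j ∧
    exportExp (rsField Γ (v p)) (fun k => rsCurve Γ (X p k)) (fun k => axialPot Γ (w p k) (c p k))
        (ρ/4) Rw j ≠ ⊤ :=
  (h p hp j).1 hj

/-- **Reading the certificate on the face `p_j = 0`.** [folklore] -/
theorem ExchangeCertificate.face_zero {Γ ρ Rw g₀ : ℝ} {γ : (Fin N → ℝ) → Fin N → ℝ}
    {X : (Fin N → ℝ) → Fin N → ℝ → EuclideanSpace ℝ (Fin 3)} {w : (Fin N → ℝ) → Fin N → ℝ → ℝ}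
    {c : (Fin N → ℝ) → Fin N → ℝ}
    {v : (Fin N → ℝ) → EuclideanSpace ℝ (Fin 3) → EuclideanSpace ℝ (Fin 3)}
    (h : ExchangeCertificate N Γ ρ Rw g₀ γ X w c v) {p : Fin N → ℝ} (hp : ∀ i, p i ∈ Icc (0:ℝ) 1)
    {j : Fin N} (hj : p j = 0) :
    importExpOr (rsField Γ (v p)) (fun k => rsCurve Γ (X p k)) (fun k => Real.sign (γ p k))
        (fun k => axialPot Γ (w p k) (c p k)) (ρ/4) Rw j 1 + ENNReal.ofReal g₀
      ≤ min (exportExp (rsField Γ (v p)) (fun k => rsCurve Γ (X p k))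
            (fun k => axialPot Γ (w p k) (c p k)) (ρ/4) Rw j)
          (importExpOr (rsField Γ (v p)) (fun k => rsCurve Γ (X p k)) (fun k => Real.sign (γ p k))
            (fun k => axialPot Γ (w p k) (c p k)) (ρ/4) Rw j (-1)) ∧
    importExpOr (rsField Γ (v p)) (fun k => rsCurve Γ (X p k)) (fun k => Real.sign (γ p k))
        (fun k => axialPot Γ (w p k) (c p k)) (ρ/4) Rw j 1 ≠ ⊤ :=
  (h p hp j).2 hj

/-- **Assembling the certificate** from its two face clauses (the certifier's entry point).
[folklore] -/
theorem ExchangeCertificate.of_faces {Γ ρ Rw g₀ : ℝ} {γ : (Fin N → ℝ) → Fin N → ℝ}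
    {X : (Fin N → ℝ) → Fin N → ℝ → EuclideanSpace ℝ (Fin 3)} {w : (Fin N → ℝ) → Fin N → ℝ → ℝ}
    {c : (Fin N → ℝ) → Fin N → ℝ}
    {v : (Fin N → ℝ) → EuclideanSpace ℝ (Fin 3) → EuclideanSpace ℝ (Fin 3)}
    (h1 : ∀ p : Fin N → ℝ, (∀ i, p i ∈ Icc (0:ℝ) 1) → ∀ j : Fin N, p j = 1 →
      exportExp (rsField Γ (v p)) (fun k => rsCurve Γ (X p k)) (fun k => axialPot Γ (w p k) (c p k))
          (ρ/4) Rw j + ENNReal.ofReal g₀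
        ≤ importExp (rsField Γ (v p)) (fun k => rsCurve Γ (X p k)) (fun k => axialPot Γ (w p k) (c p k))
          (ρ/4) Rw j ∧
      exportExp (rsField Γ (v p)) (fun k => rsCurve Γ (X p k)) (fun k => axialPot Γ (w p k) (c p k))
          (ρ/4) Rw j ≠ ⊤)
    (h0 : ∀ p : Fin N → ℝ, (∀ i, p i ∈ Icc (0:ℝ) 1) → ∀ j : Fin N, p j = 0 →
      importExpOr (rsField Γ (v p)) (fun k => rsCurve Γ (X p k)) (fun k => Real.sign (γ p k))
          (fun k => axialPot Γ (w p k) (c p k)) (ρ/4) Rw j 1 + ENNReal.ofReal g₀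
        ≤ min (exportExp (rsField Γ (v p)) (fun k => rsCurve Γ (X p k))
              (fun k => axialPot Γ (w p k) (c p k)) (ρ/4) Rw j)
            (importExpOr (rsField Γ (v p)) (fun k => rsCurve Γ (X p k)) (fun k => Real.sign (γ p k))
              (fun k => axialPot Γ (w p k) (c p k)) (ρ/4) Rw j (-1)) ∧
      importExpOr (rsField Γ (v p)) (fun k => rsCurve Γ (X p k)) (fun k => Real.sign (γ p k))
          (fun k => axialPot Γ (w p k) (c p k)) (ρ/4) Rw j 1 ≠ ⊤) :
    ExchangeCertificate N Γ ρ Rw g₀ γ X w c v :=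
  fun p hp j => ⟨h1 p hp j, h0 p hp j⟩

end Summit.NavierStokesRegularity.NavierStokesRegularity.Theorems.FilamentExchange

end
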